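import Summits.PneNP.PneNP.Theorems.ConvexRankGatesConvexGateBlindExactLiftingTriangleVertex

/-!
# Triangle instance — the vanishing lemma: a combination of line patterns that vanishes wherever a line is
# bichromatic, and the two-line lemma

Support file for crux `ConvexGateBlind` (stmt-PneNP-10680), open stub `stub_exactLifting`; prover seat 0, session 36,
memo ANALYSIS15 §2. Second of three files proving regrouping rigidity of the cheap corner of `M_t` unconditionally.

For `β : Line t → ℝ` put `ψ_β(x) = Σ_L β_L [L mono_x]` (`lcomb`). Suppose `ψ_β` vanishes on every NONDEGENERATE row under which
the line `K = {p, q}` (third block `T`) is bichromatic (`VanOn β K`). Evaluating suitable four-point functionals inside that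
set of rows (file `…TriangleVertex`) gives, for `t ≥ 4`:
* `VanOn.avoid`   — `β_L = 0` for every line `L` avoiding `p` and `q`;
* `VanOn.shared`  — `β_{sr} = 0` for `s ∈ {p,q}` and `r ≠` the other end, `r` in the other end's block;
* `VanOn.third`   — `β_{pr} = β_{qr}` for `r ∈ T`;
* `VanOn.sum_third` — `Σ_{r ∈ T} β_{sr} = 0` (`s ∈ {p,q}`).
So the solution space has dimension `t` (spanned by `e_K` and the balanced `p/q`-fans into `T`; exact rank check `t = 3, 4` in
the memo). **Two-line lemma** (`VanOn.eq_zero_of_two`, registered form `triangle_two_line_vanishing`): if `ψ_β` vanishes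
wherever `K₁` is bichromatic AND wherever `K₂ ≠ K₁` is bichromatic, then `β = 0`. This is the combinatorial heart of regrouping
rigidity: a regrouping generator built from two different lines would have a usage function of this kind (next file).
-/

set_option linter.dupNamespace false -- `Summit.PneNP.PneNP.…`: summit = sub-problem (D-0017)

namespace Summit.PneNP.PneNP.Theorems.XorDoor.TriLine

open Finset

noncomputable section

variable {t : ℕ}

/-! ## Combinations of line patterns -/

/-- `ψ_β(x) = Σ_L β_L [L mono_x]` -/
def lcomb (β : Line t → ℝ) (x : Col t) : ℝ := ∑ L, β L * mInd x L

/-- `ψ_β` vanishes on the nondegenerate rows under which `K` is bichromatic -/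
def VanOn (β : Line t → ℝ) (K : Line t) : Prop := ∀ x : Col t, mu x ≠ 0 → ¬ lmono x K → lcomb β x = 0

/-- the four-point functional of a combination -/
lemma dfun_lcomb (x : Col t) (p q : Vtx t) (β : Line t → ℝ) :
    dfun x p q (lcomb β) = ∑ L, β L * dfun x p q (fun y => mInd y L) := by
  unfold lcomb; exact dfun_sum univ x p q β (fun L y => mInd y L)

/-! ## Small bookkeeping -/

/-- the other end of `L` from an end `s` -/
lemma exists_other_end {s : Vtx t} {L : Line t} (hs : onL s L) : ∃ r, onL r L ∧ r ≠ s ∧ L = vline s r := by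
  rcases hs with hs | hs
  · exact ⟨e2 L, Or.inr rfl, fun h => e1_ne_e2 L (hs ▸ h.symm), by rw [hs, vline_e1_e2]⟩
  · exact ⟨e1 L, Or.inl rfl, fun h => e1_ne_e2 L (hs ▸ h), by rw [hs, vline_e2_e1]⟩

/-- ends of `vline v w` -/
lemma onL_vline_iff {u v w : Vtx t} (h : v.1 ≠ w.1) : onL u (vline v w) ↔ u = v ∨ u = w := by
  unfold onL
  rcases ends_vline h with ⟨h1, h2⟩ | ⟨h1, h2⟩ <;> rw [h1, h2]
  exact Or.comm

/-- **Position of a line relative to `K`**: it avoids both ends, or is `K`, or shares exactly one end `s` with `K` — the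
other end `r` lying either in the block of the other end of `K` or in the third block. -/
lemma classify (K L : Line t) :
    (¬ onL (e1 K) L ∧ ¬ onL (e2 K) L) ∨ L = K ∨
      (∃ s r, onL s K ∧ ¬ onL r K ∧ r.1 ≠ s.1 ∧ r.1 ≠ tb K ∧ L = vline s r) ∨
        (∃ s r, onL s K ∧ r.1 = tb K ∧ L = vline s r) := by
  by_cases h1 : onL (e1 K) L
  · by_cases h2 : onL (e2 K) L
    · right; left
      rw [eq_vline h1 h2 (e1_ne_e2 K), vline_e1_e2]
    · obtain ⟨r, hr, hrs, hL⟩ := exists_other_end h1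
      have hrK : ¬ onL r K := by
        rintro (h | h)
        · exact hrs h
        · exact h2 (h ▸ hr)
      have hfst : r.1 ≠ (e1 K).1 := fst_ne_fst_of_onL hr h1 hrs
      by_cases hT : r.1 = tb K
      · right; right; right; exact ⟨e1 K, r, Or.inl rfl, hT, hL⟩
      · right; right; left; exact ⟨e1 K, r, Or.inl rfl, hrK, hfst, hT, hL⟩
  · by_cases h2 : onL (e2 K) L
    · obtain ⟨r, hr, hrs, hL⟩ := exists_other_end h2
      have hrK : ¬ onL r K := by
        rintro (h | h)
        · exact h1 (h ▸ hr)
        · exact hrs h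
      have hfst : r.1 ≠ (e2 K).1 := fst_ne_fst_of_onL hr h2 hrs
      by_cases hT : r.1 = tb K
      · right; right; right; exact ⟨e2 K, r, Or.inr rfl, hT, hL⟩
      · right; right; left; exact ⟨e2 K, r, Or.inr rfl, hrK, hfst, hT, hL⟩
    · left; exact ⟨h1, h2⟩

/-- a set of vertices in pairwise different blocks has at most one vertex per block -/
lemma card_filter_fst_le_one {A : Finset (Vtx t)} (hA : ∀ v ∈ A, ∀ w ∈ A, v ≠ w → v.1 ≠ w.1) (i : Fin 3) :
    (A.filter fun v => v.1 = i).card ≤ 1 := by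
  refine card_le_one.2 fun v hv w hw => ?_
  rw [mem_filter] at hv hw
  by_contra hne
  exact hA v hv.1 w hw.1 hne (hv.2.trans hw.2.symm)

/-- two such sets together have at most two vertices per block -/
lemma card_filter_fst_union_le_two {A B : Finset (Vtx t)} (hA : ∀ v ∈ A, ∀ w ∈ A, v ≠ w → v.1 ≠ w.1)
    (hB : ∀ v ∈ B, ∀ w ∈ B, v ≠ w → v.1 ≠ w.1) (i : Fin 3) : ((A ∪ B).filter fun v => v.1 = i).card ≤ 2 := by
  rw [filter_union]
  calc ((A.filter fun v => v.1 = i) ∪ (B.filter fun v => v.1 = i)).card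
      ≤ (A.filter fun v => v.1 = i).card + (B.filter fun v => v.1 = i).card := card_union_le _ _
    _ ≤ 1 + 1 := Nat.add_le_add (card_filter_fst_le_one hA i) (card_filter_fst_le_one hB i)

/-- the two ends of a line are in different blocks (finset form) -/
lemma ends_blocks (L : Line t) :
    ∀ v ∈ ({e1 L, e2 L} : Finset (Vtx t)), ∀ w ∈ ({e1 L, e2 L} : Finset (Vtx t)), v ≠ w → v.1 ≠ w.1 := by
  intro v hv w hw hvw
  simp only [mem_insert, mem_singleton] at hv hw
  have hv' : onL v L := hv
  have hw' : onL w L := hw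
  exact fst_ne_fst_of_onL hv' hw' hvw

/-- a singleton trivially has pairwise different blocks -/
lemma singleton_blocks (r : Vtx t) :
    ∀ v ∈ ({r} : Finset (Vtx t)), ∀ w ∈ ({r} : Finset (Vtx t)), v ≠ w → v.1 ≠ w.1 := by
  intro v hv w hw hvw
  rw [mem_singleton] at hv hw
  exact absurd (hv.trans hw.symm) hvw

/-- bichromaticity of `K` in terms of `col` -/
lemma not_lmono_iff_col (x : Col t) (K : Line t) :
    ¬ lmono x K ↔ col x (e1 K).1 (e1 K).2 ≠ col x (e2 K).1 (e2 K).2 := by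
  rw [lmono_iff_col]

/-- a flip away from the ends of `K` does not change the pattern of `K` -/
lemma lmono_flipV_of_not_onL {v : Vtx t} {K : Line t} (hv : ¬ onL v K) (x : Col t) :
    lmono (flipV v x) K ↔ lmono x K := by
  rw [lmono_flipV]; tauto

/-- flipping BOTH ends of `K` does not change the pattern of `K` -/
lemma lmono_flip_both (K : Line t) (x : Col t) : lmono (flipV (e1 K) (flipV (e2 K) x)) K ↔ lmono x K := by
  rw [lmono_flipV, lmono_flipV]
  have h1 : onL (e1 K) K := Or.inl rfl
  have h2 : onL (e2 K) K := Or.inr rfl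
  tauto

namespace VanOn

variable {β : Line t → ℝ} {K : Line t}

/-! ## Lines avoiding the ends of `K` -/

/-- **`β_L = 0` for every line avoiding both ends of `K`.** Functional: flips at the two ends of `L`, at a robust row with
`K` bichromatic and `L` monochromatic. -/
theorem avoid (hV : VanOn β K) (ht : 4 ≤ t) {L : Line t} (h1 : ¬ onL (e1 K) L) (h2 : ¬ onL (e2 K) L) : β L = 0 := by
  classical
  set p := e1 L with hp
  set q := e2 L with hq
  -- a robust base row: `K` bichromatic, `L` monochromatic
  set S : Finset (Vtx t) := {e1 K, e2 K} ∪ {p, q} with hSdef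
  have hS := card_filter_fst_union_le_two (ends_blocks K) (ends_blocks L)
  obtain ⟨x, hR, hreq⟩ := exists_robust ht S hS (fun v => if v = e2 K then false else true)
  have hpS : p ∈ S := by simp [hSdef]
  have hqS : q ∈ S := by simp [hSdef]
  have hK1 : col x (e1 K).1 (e1 K).2 = true := by
    have := hreq (e1 K) (by simp [hSdef]); rwa [if_neg (e1_ne_e2 K)] at this
  have hK2 : col x (e2 K).1 (e2 K).2 = false := by
    have := hreq (e2 K) (by simp [hSdef]); rwa [if_pos rfl] at this
  have hpK : ¬ onL p K := by
    intro h; unfold onL at h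
    rcases h with h | h
    · exact h1 (Or.inl (h.symm.trans hp))
    · exact h2 (Or.inl (h.symm.trans hp))
  have hqK : ¬ onL q K := by
    intro h; unfold onL at h
    rcases h with h | h
    · exact h1 (Or.inr (h.symm.trans hq))
    · exact h2 (Or.inr (h.symm.trans hq))
  have hKb : ¬ lmono x K := by rw [not_lmono_iff_col, hK1, hK2]; decide
  -- the four rows
  have e0 : lcomb β x = 0 := hV x (mu_ne_zero_of_robust hR) hKb
  have eP : lcomb β (flipV p x) = 0 :=
    hV _ (mu_ne_zero_of_robust (robust_flipV hR hpS)) (by rwa [lmono_flipV_of_not_onL hpK])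
  have eQ : lcomb β (flipV q x) = 0 :=
    hV _ (mu_ne_zero_of_robust (robust_flipV hR hqS)) (by rwa [lmono_flipV_of_not_onL hqK])
  have ePQ : lcomb β (flipV p (flipV q x)) = 0 :=
    hV _ (mu_ne_zero_of_robust (robust_flipV (robust_flipV hR hqS) hpS))
      (by rw [lmono_flipV_of_not_onL hpK, lmono_flipV_of_not_onL hqK]; exact hKb)
  have hD : dfun x p q (lcomb β) = 0 := by unfold dfun; rw [e0, eP, eQ, ePQ]; ring
  -- evaluate the functional
  have hpq : p.1 ≠ q.1 := ne_of_lt (e1_fst_lt_e2_fst L)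
  rw [dfun_lcomb] at hD
  rw [Fintype.sum_eq_single L] at hD
  · have hm : mInd x L = 1 := by
      have hpv : col x p.1 p.2 = true := by
        have := hreq p hpS; rwa [if_neg (fun h => hpK (Or.inr h))] at this
      have hqv : col x q.1 q.2 = true := by
        have := hreq q hqS; rwa [if_neg (fun h => hqK (Or.inr h))] at this
      unfold mInd; rw [if_pos]; rw [lmono_iff_col, ← hp, ← hq, hpv, hqv]
    rw [dfun_mInd, if_pos ⟨Or.inl rfl, Or.inr rfl⟩, hm] at hD
    linarith
  · intro L' hL'
    rw [dfun_mInd, if_neg, mul_zero]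
    rw [onL_and_onL_iff hpq, hp, hq, vline_e1_e2]
    exact hL'

/-! ## Lines through exactly one end of `K` -/

/-- the lines seen by the functional "flip both ends of `K`, flip `r`": those through `r` and exactly one end of `K` -/
lemma dfun2_mInd (x : Col t) (K : Line t) (r : Vtx t) (L : Line t) :
    mInd x L - mInd (flipV (e1 K) (flipV (e2 K) x)) L - mInd (flipV r x) L +
        mInd (flipV (e1 K) (flipV (e2 K) (flipV r x))) L =
      if ¬ (onL (e1 K) L ↔ onL (e2 K) L) ∧ onL r L then 4 * mInd x L - 2 else 0 := by
  simp only [mInd_flipV]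
  by_cases h1 : onL (e1 K) L <;> by_cases h2 : onL (e2 K) L <;> by_cases hr : onL r L <;> simp [h1, h2, hr] <;> ring

/-- the four rows of that functional annihilate `ψ_β` (base row robust outside `{e1 K, e2 K, r}`, `K` bichromatic, `r` not an
end of `K`) -/
lemma dfun2_lcomb (hV : VanOn β K) {x : Col t} {r : Vtx t} (hR : Robust ({e1 K, e2 K} ∪ {r}) x) (hKb : ¬ lmono x K)
    (hrK : ¬ onL r K) :
    ∑ L, β L * (if ¬ (onL (e1 K) L ↔ onL (e2 K) L) ∧ onL r L then 4 * mInd x L - 2 else 0) = 0 := by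
  classical
  have h1S : e1 K ∈ ({e1 K, e2 K} ∪ {r} : Finset (Vtx t)) := by simp
  have h2S : e2 K ∈ ({e1 K, e2 K} ∪ {r} : Finset (Vtx t)) := by simp
  have hrS : r ∈ ({e1 K, e2 K} ∪ {r} : Finset (Vtx t)) := by simp
  have e0 : lcomb β x = 0 := hV x (mu_ne_zero_of_robust hR) hKb
  have eF : lcomb β (flipV (e1 K) (flipV (e2 K) x)) = 0 :=
    hV _ (mu_ne_zero_of_robust (robust_flipV (robust_flipV hR h2S) h1S)) (by rwa [lmono_flip_both])
  have eR : lcomb β (flipV r x) = 0 :=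
    hV _ (mu_ne_zero_of_robust (robust_flipV hR hrS)) (by rwa [lmono_flipV_of_not_onL hrK])
  have eFR : lcomb β (flipV (e1 K) (flipV (e2 K) (flipV r x))) = 0 :=
    hV _ (mu_ne_zero_of_robust (robust_flipV (robust_flipV (robust_flipV hR hrS) h2S) h1S))
      (by rw [lmono_flip_both, lmono_flipV_of_not_onL hrK]; exact hKb)
  have key : lcomb β x - lcomb β (flipV (e1 K) (flipV (e2 K) x)) - lcomb β (flipV r x) +
      lcomb β (flipV (e1 K) (flipV (e2 K) (flipV r x))) = 0 := by rw [e0, eF, eR, eFR]; ring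
  unfold lcomb at key
  rw [← sum_sub_distrib, ← sum_sub_distrib, ← sum_add_distrib] at key
  calc ∑ L, β L * (if ¬ (onL (e1 K) L ↔ onL (e2 K) L) ∧ onL r L then 4 * mInd x L - 2 else 0)
      = ∑ L, (β L * mInd x L - β L * mInd (flipV (e1 K) (flipV (e2 K) x)) L - β L * mInd (flipV r x) L +
          β L * mInd (flipV (e1 K) (flipV (e2 K) (flipV r x))) L) := by
        refine sum_congr rfl fun L _ => ?_
        rw [← dfun2_mInd x K r L]; ring
    _ = 0 := key

/-- a robust base row for the one-end functionals: `e1 K ↦ true`, `e2 K ↦ false`, `r ↦ c` -/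
lemma exists_base2 (ht : 4 ≤ t) (K : Line t) {r : Vtx t} (hrK : ¬ onL r K) (c : Bool) :
    ∃ x : Col t, Robust ({e1 K, e2 K} ∪ {r}) x ∧ col x (e1 K).1 (e1 K).2 = true ∧ col x (e2 K).1 (e2 K).2 = false ∧
      col x r.1 r.2 = c := by
  classical
  have hS := card_filter_fst_union_le_two (ends_blocks K) (singleton_blocks r)
  obtain ⟨x, hR, hreq⟩ := exists_robust ht _ hS (fun v => if v = e1 K then true else if v = e2 K then false else c)
  have hr1 : r ≠ e1 K := fun h => hrK (h ▸ Or.inl rfl)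
  have hr2 : r ≠ e2 K := fun h => hrK (h ▸ Or.inr rfl)
  refine ⟨x, hR, ?_, ?_, ?_⟩
  · have := hreq (e1 K) (by simp); rwa [if_pos rfl] at this
  · have := hreq (e2 K) (by simp); rwa [if_neg (e1_ne_e2 K).symm, if_pos rfl] at this
  · have := hreq r (by simp); rwa [if_neg hr1, if_neg hr2] at this

/-- **`β_{sr} = 0` for a line through exactly one end `s` of `K` whose other end `r` lies in the block of the other end of
`K`.** -/
theorem shared (hV : VanOn β K) (ht : 4 ≤ t) {s r : Vtx t} (hs : onL s K) (hrK : ¬ onL r K) (hrs : r.1 ≠ s.1)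
    (hrT : r.1 ≠ tb K) : β (vline s r) = 0 := by
  classical
  -- base row with `r` coloured like `s`
  obtain ⟨x, hR, hK1, hK2, hrc⟩ := exists_base2 ht K hrK (if s = e1 K then true else false)
  have hKb : ¬ lmono x K := by rw [not_lmono_iff_col, hK1, hK2]; decide
  have hsum := dfun2_lcomb hV hR hKb hrK
  -- only the line `vline s r` survives
  have hsv : col x s.1 s.2 = (if s = e1 K then true else false) := by
    rcases hs with h | h
    · rw [h, if_pos rfl, hK1]
    · rw [h, if_neg (e1_ne_e2 K).symm, hK2]
  rw [Fintype.sum_eq_single (vline s r)] at hsum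
  · have hm : mInd x (vline s r) = 1 := by
      unfold mInd; rw [if_pos]
      rw [lmono_iff_col]
      rcases ends_vline hrs.symm with ⟨h1, h2⟩ | ⟨h1, h2⟩ <;> rw [h1, h2, hsv, hrc]
    have hcond : ¬ (onL (e1 K) (vline s r) ↔ onL (e2 K) (vline s r)) ∧ onL r (vline s r) := by
      refine ⟨?_, onL_vline_right hrs.symm⟩
      rw [onL_vline_iff hrs.symm, onL_vline_iff hrs.symm]
      have hr1 : e1 K ≠ r := fun h => hrK (h ▸ Or.inl rfl)
      have hr2 : e2 K ≠ r := fun h => hrK (h ▸ Or.inr rfl)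
      rcases hs with h | h <;> subst h <;> simp [hr1, hr2, e1_ne_e2 K, (e1_ne_e2 K).symm]
    rw [if_pos hcond, hm] at hsum
    linarith
  · intro L hL
    rw [mul_eq_zero]; right
    rw [if_neg]
    rintro ⟨hx, hr⟩
    -- `L` passes through `r` and exactly one end of `K`; that end must be `s`
    apply hL
    rcases hs with h | h <;> subst h
    · by_cases h1 : onL (e1 K) L
      · exact eq_vline h1 hr (fun e => hrK (e ▸ Or.inl rfl))
      · have h2 : onL (e2 K) L := by
          by_contra h2; exact hx ⟨fun h => absurd h h1, fun h => absurd h h2⟩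
        -- then `r` and `e2 K` are two ends of `L` in the same block: impossible
        exfalso
        rcases block_cases K r.1 with hb | hb | hb
        · exact hrs hb
        · exact fst_ne_fst_of_onL hr h2 (fun e => hrK (e ▸ Or.inr rfl)) hb
        · exact hrT hb
    · by_cases h2 : onL (e2 K) L
      · exact eq_vline h2 hr (fun e => hrK (e ▸ Or.inr rfl))
      · have h1 : onL (e1 K) L := by
          by_contra h1; exact hx ⟨fun h => absurd h h1, fun h => absurd h h2⟩
        exfalso
        rcases block_cases K r.1 with hb | hb | hb
        · exact fst_ne_fst_of_onL hr h1 (fun e => hrK (e ▸ Or.inl rfl)) hb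
        · exact hrs hb
        · exact hrT hb

/-- **`β_{pr} = β_{qr}` for `r` in the third block of `K = {p,q}`.** -/
theorem third (hV : VanOn β K) (ht : 4 ≤ t) {r : Vtx t} (hr : r.1 = tb K) :
    β (vline (e1 K) r) = β (vline (e2 K) r) := by
  classical
  have hrK : ¬ onL r K := not_onL_of_fst_eq_tb hr
  obtain ⟨x, hR, hK1, hK2, hrc⟩ := exists_base2 ht K hrK true
  have hKb : ¬ lmono x K := by rw [not_lmono_iff_col, hK1, hK2]; decide
  have hsum := dfun2_lcomb hV hR hKb hrK
  have hr1 : (e1 K).1 ≠ r.1 := by rw [hr]; exact (tb_ne_e1_fst K).symm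
  have hr2 : (e2 K).1 ≠ r.1 := by rw [hr]; exact (tb_ne_e2_fst K).symm
  have hne : vline (e1 K) r ≠ vline (e2 K) r := by
    intro h
    have : onL (e1 K) (vline (e2 K) r) := h ▸ onL_vline_left hr1
    rw [onL_vline_iff hr2] at this
    rcases this with h' | h'
    · exact e1_ne_e2 K h'
    · exact hrK (h' ▸ Or.inl rfl)
  have hre1 : r ≠ e1 K := fun h => hrK (h ▸ Or.inl rfl)
  have hre2 : r ≠ e2 K := fun h => hrK (h ▸ Or.inr rfl)
  rw [Fintype.sum_eq_add (vline (e1 K) r) (vline (e2 K) r) hne] at hsum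
  · have hm1 : mInd x (vline (e1 K) r) = 1 := by
      unfold mInd; rw [if_pos]; rw [lmono_iff_col]
      rcases ends_vline hr1 with ⟨h1, h2⟩ | ⟨h1, h2⟩ <;> rw [h1, h2, hK1, hrc]
    have hm2 : mInd x (vline (e2 K) r) = 0 := by
      unfold mInd; rw [if_neg]; rw [lmono_iff_col]
      rcases ends_vline hr2 with ⟨h1, h2⟩ | ⟨h1, h2⟩ <;> rw [h1, h2, hK2, hrc] <;> decide
    have hc1 : ¬ (onL (e1 K) (vline (e1 K) r) ↔ onL (e2 K) (vline (e1 K) r)) ∧ onL r (vline (e1 K) r) := by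
      refine ⟨?_, onL_vline_right hr1⟩
      rw [onL_vline_iff hr1, onL_vline_iff hr1]
      simp [(e1_ne_e2 K).symm, hre2.symm]
    have hc2 : ¬ (onL (e1 K) (vline (e2 K) r) ↔ onL (e2 K) (vline (e2 K) r)) ∧ onL r (vline (e2 K) r) := by
      refine ⟨?_, onL_vline_right hr2⟩
      rw [onL_vline_iff hr2, onL_vline_iff hr2]
      simp [e1_ne_e2 K, hre1.symm]
    rw [if_pos hc1, if_pos hc2, hm1, hm2] at hsum
    linarith
  · intro L ⟨hL1, hL2⟩
    rw [mul_eq_zero]; right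
    rw [if_neg]
    rintro ⟨hx, hrL⟩
    by_cases h1 : onL (e1 K) L
    · exact hL1 (eq_vline h1 hrL hre1.symm)
    · have h2 : onL (e2 K) L := by
        by_contra h2; exact hx ⟨fun h => absurd h h1, fun h => absurd h h2⟩
      exact hL2 (eq_vline h2 hrL hre2.symm)

end VanOn

/-- **Coefficient constraints from one vanishing line** (registered sub-goal `triangle_vanishing_coefficients` of
stmt-PneNP-10680, verbatim signature; vocabulary of `…TriangleVertex` and this file): for `t ≥ 4`, if `ψ_β` vanishes on the
nondegenerate rows under which `K` is bichromatic, then `β_L = 0` for every line `L` avoiding both ends of `K`, and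
`β_{pr} = β_{qr}` for `p, q` the ends of `K` and every vertex `r` of its third block. -/
theorem triangle_vanishing_coefficients : ∀ (t : ℕ), 4 ≤ t → ∀ (β : Line t → ℝ) (K : Line t), VanOn β K →
    (∀ L : Line t, ¬ onL (e1 K) L → ¬ onL (e2 K) L → β L = 0) ∧
      ∀ r : Fin 3 × Fin t, r.1 = tb K → β (vline (e1 K) r) = β (vline (e2 K) r) :=
  fun _ ht _ _ hV => ⟨fun _ h1 h2 => hV.avoid ht h1 h2, fun _ hr => hV.third ht hr⟩

end

end Summit.PneNP.PneNP.Theorems.XorDoor.TriLine
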